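import Summits.QuantumFields.BalabanUV.Beta.FP.HorizontalBookkeeping
import Literature.MathematicalPhysics.QuantumFieldTheory.Balaban1983to89.Beta.OneStepKernelFamily
import Literature.MathematicalPhysics.QuantumFieldTheory.Balaban1983to89.Beta.TransferUV
import Literature.MathematicalPhysics.QuantumFieldTheory.Balaban1983to89.Beta.DyadicShell

/-!
# `BalabanUV.Beta.FP.TruncatedFirstMoment` — road «FP» for binder row D1, organisation γ (FINDING F-d1leaf01g10-1, repair (R2)): THE FIRST MOMENTS OF THE
# TRUNCATED KERNEL `truncK K N` FROM THE PRINTED REFLECTION COVARIANCE (5.7) AND SEXTIC DECAY ONLY — `|Σ_{‖t‖∞≤N} t_κ·K c e t| ≤ 80·C∕(N+1)²`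
# for every channel `(c,e)` and direction `κ` (exactly `0` unless `c ≠ e` and `κ ∈ {c,e}`, where it is a boundary-shell term)

HONEST DEPENDENCY (page 1, mandatory): continuum YM on T⁴ ⇐ BetaPertH ∧ nine spine estimates (0/9 proved); BetaPertH ⇐ (D1) ∧ (D4) ∧
CAP+tail; G-an2-4 gates asym, D1 and NE2/3/4.  HONEST FRAMING (cell contract, verbatim): «discharging `BetaPertH` makes Bałaban's UV
stability UNCONDITIONAL — a real constructive-QFT result; it is NOT the continuum limit and NOT the Clay problem.»  THIS MODULE is elementary
[folklore] lattice summation on `ℤ⁴` (re-indexing by the involutions `z ↦ ε_κ z`, `z ↦ ε_a z ± e_a`; shell counting `#{‖z‖∞ = r+1} ≤ 80(r+1)³` BY NAME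
from `TransferUV.card_annulus_succ_four_le`); the reflection covariance is the tree's [cite]-tagged PREDICATE `PolarizationSign.AxisReflectionCovariant`
((5.7)–(5.8) p. 293 of [Balaban1987RG1]) taken as a HYPOTHESIS on an abstract kernel and asserted of nothing.  No `def`, no `def … : Prop`, nothing cited,
0 sorry; 0 estimates of Bałaban's objects; 0∕4 row-D1 binders; NOT hbook, NOT hasym, NOT D1, NOT BetaPertH, NOT continuum, NOT Clay.

ABSOLUTE RULE (cell charter, verbatim): «No internally-minted statement may enter as a cited fact. Every hypothesis is either kernel-proved in this
package or a verbatim quotation of a PUBLISHED theorem with page reference. The manuscript(s) under audit are NOT citable for their own disputed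
steps — they are the thing under adjudication; programme-internal (2001/route/tribunal) claims are never citable.»

WHY (F-d1leaf01g10-1, `HOME/GAPS.md` l.35502; `FP/EvenKernelNoGo`).  The γ-END chain (`FP/HorizontalBookkeeping` §2–§4 → `HorizontalTailAssembly.hasSum_truncatedTransport` →
`HorizontalRemainderPerfect` → `RemainderLedger`) kills the four m₁-terms of the nine-term identity `HorizontalBookkeeping.decimatedSum_second_moment_hasSum_lattice_nine`
by the letter `heven` (entrywise evenness of the transported kernel `K`), which no reflection-covariant kernel with a non-zero off-diagonal channel satisfies
(`EvenKernelNoGo.offDiag_eq_zero_of_even_of_cov_flip`).  What the road's kernels DO have is (5.7) in the kernel convention, `AxisReflectionCovariant (flipK K)`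
(road FP's N3 ∕ the wall's hR shape).  From it the first moments of the FULL kernel vanish exactly (`OddMoments.firstMoment_eq_zero_of_reflectionCovariant`, in tree);
for the TRUNCATED kernel the sup-ball `‖t‖∞ ≤ N` is invariant under `ε_κ` but not under the shifted reflections `ε_a z ± e_a` of the two index axes, so the in-plane
first moments of an off-diagonal channel are BOUNDARY-SHELL sums — small: this file's letter.  It is the `hA₁`-input of the (R2) re-cut of the END
(`|m₁(truncK K N c e)| ≤ A₁∕N²`, `A₁ := 80·C`), in the same currency as leaf-05's (T0) letter `TruncatedZerothMoment.abs_tsum_truncK_le_of_hasSum_zero` (`A := 40·C`) —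
and unlike the (T0) letter it needs NO Ward∕total-mass hypothesis.

CONTENT (all [folklore]):
* §1 scalar lemmas on `Pt = ℤ⁴`: `supNorm_axisReflect`; **`sum_box_coord_mul_eq_zero_of_invariant`** (`f ∘ ε_κ = f ⟹ Σ_{box N} t_κ f t = 0`);
  **`abs_sum_box_coord_mul_le_of_antiShift`** (`f (ε_a z + σ e_a) = −f z` with `a ≠ κ`, `σ = ±1`, `|f z| ≤ C∕(‖z‖∞+1)⁶`, `N ≥ 1` ⟹ `|Σ_{box N} t_κ f t| ≤ 80C∕(N+1)²`:
  the involution pairs the box with its unit shift; what survives lives on the two shells `‖z‖∞ ∈ {N, N+1}`).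
* §2 the kernel letter: `cov_flip_apply` (the flipped law unfolded), **`abs_firstMoment_truncK_le_of_cov_flip`** (`AxisReflectionCovariant (flipK K)` + (K6) ⟹
  `|Σ' t, t κ • truncK K N c e t| ≤ 80C∕(N+1)²`, all `c e κ`, `N ≥ 1`), the `N⁻²` form **`abs_firstMoment_truncK_le_of_cov_flip'`** (`≤ 80C∕N²`), the exact vanishing
  `firstMoment_truncK_eq_zero_of_cov_flip` when `c = e ∨ (κ ≠ c ∧ κ ≠ e)`, and the unflipped-covariance twin `abs_firstMoment_truncK_le_of_cov`.
Provenance: D1 formalisation swarm, unit b2b-balaban-beta-d1-formalise-leaf-01 gen 10 (prover-b2b-balaban-beta-d1-formalise-leaf-01-g10-0), 2026-08-21; «not in print; our bookkeeping».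
-/

noncomputable section

namespace Summit.QuantumFields.BalabanUV.Beta.FP.TruncatedFirstMoment

open Finset
open Literature.Probability.LatticeModels (box mem_box annulus mem_annulus)
open Literature.MathematicalPhysics.QuantumFieldTheory.Balaban1983to89
open Literature.MathematicalPhysics.QuantumFieldTheory.Balaban1983to89.Beta
open Literature.MathematicalPhysics.QuantumFieldTheory.Balaban1983to89.B6BondElimination (unitVec unitVec_apply)
open PolarizationSign (AxisReflectionCovariant axisReflect axisReflect_apply axisReflect_axisReflect reflSign)
open OneStepKernelFamily (flipK flipK_apply flipK_flipK axisReflectionCovariant_flipK_iff)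
open DressedMomentNormalisation (EKer)
open DyadicShell (Pt supNorm natAbs_le_supNorm supNorm_le_iff mem_box_iff not_mem_box_iff mem_annulus_iff annulus_eq_union disjoint_annulus)
open GradedBubbles (supNorm_neg)
open TransferUV (card_annulus_succ_four_le)
open Summit.QuantumFields.BalabanUV.Beta.FP.HorizontalBookkeeping (truncK truncK_apply truncK_eq_zero_of_not_mem tsum_smul_truncK_eq_sum)

/-! ## §1 Scalar lemmas on `ℤ⁴` -/

section Scalar

/-- [folklore] An axis reflection preserves the sup norm. -/
theorem supNorm_axisReflect (α : Fin 4) (z : Pt) : supNorm (axisReflect α z) = supNorm z := by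
  unfold DyadicShell.supNorm
  congr 1
  funext i
  simp only [axisReflect_apply]
  split_ifs <;> simp

/-- [folklore] The shifted reflection `z ↦ ε_a z + σ•e_a` is an involution of `ℤ⁴`. -/
theorem shiftRefl_shiftRefl (a : Fin 4) (σ : ℤ) (z : Pt) :
    axisReflect a (axisReflect a z + σ • unitVec a) + σ • unitVec a = z := by
  funext i
  simp only [Pi.add_apply, axisReflect_apply, Pi.smul_apply, unitVec_apply, smul_eq_mul]
  split_ifs <;> ring

/-- **[folklore] INVARIANCE KILLS THE FIRST MOMENT ON THE BOX**: if `f (ε_κ z) = f z` for all `z` then `Σ_{‖t‖∞≤N} t_κ·f t = 0` (the box is `ε_κ`-symmetric and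
the weight odd). -/
theorem sum_box_coord_mul_eq_zero_of_invariant {f : Pt → ℝ} (κ : Fin 4) (hf : ∀ z, f (axisReflect κ z) = f z) (N : ℕ) :
    ∑ t ∈ box 4 N, (t κ : ℝ) * f t = 0 := by
  have h : ∑ t ∈ box 4 N, ((axisReflect κ t) κ : ℝ) * f (axisReflect κ t) = ∑ t ∈ box 4 N, (t κ : ℝ) * f t :=
    Finset.sum_equiv (⟨axisReflect κ, axisReflect κ, axisReflect_axisReflect κ, axisReflect_axisReflect κ⟩ : Pt ≃ Pt) (fun t => by
      show t ∈ box 4 N ↔ axisReflect κ t ∈ box 4 N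
      rw [mem_box_iff, mem_box_iff, supNorm_axisReflect]) (fun t _ => rfl)
  have h2 : ∑ t ∈ box 4 N, ((axisReflect κ t) κ : ℝ) * f (axisReflect κ t) = -∑ t ∈ box 4 N, (t κ : ℝ) * f t := by
    rw [← Finset.sum_neg_distrib]
    refine Finset.sum_congr rfl fun t _ => ?_
    rw [hf]
    simp only [axisReflect_apply, if_true, Int.cast_neg]
    ring
  linarith

/-- [folklore] Nonnegativity of the decay constant. -/
theorem nonneg_of_sextic {f : Pt → ℝ} {C : ℝ} (hdec : ∀ z : Pt, |f z| ≤ C / ((supNorm z : ℝ) + 1) ^ 6) : 0 ≤ C := by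
  have h := hdec 0
  have hp : (0 : ℝ) < ((supNorm (0 : Pt) : ℝ) + 1) ^ 6 := by positivity
  rcases div_nonneg_iff.mp ((abs_nonneg _).trans h) with h1 | h1
  · exact h1.1
  · exact absurd h1.2 (not_le.mpr hp)

/-- **[folklore] THE ANTI-SHIFT CASE IS A BOUNDARY-SHELL TERM.**  If `f (ε_a z + σ•e_a) = −f z` for all `z` (`σ = ±1`, `a ≠ κ`) and `|f z| ≤ C∕(‖z‖∞+1)⁶`, then for
`N ≥ 1`: `|Σ_{‖t‖∞≤N} t_κ·f t| ≤ 80·C∕(N+1)²`.  MECHANISM: the involution `φ z = ε_a z + σ e_a` preserves `z_κ` and flips the sign of `f`, so twice the box sum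
is `Σ_z z_κ f(z)·([z ∈ box N] − [φ z ∈ box N])`, supported on the two shells `‖z‖∞ ∈ {N, N+1}` (`≤ 80N³ + 80(N+1)³` points, `TransferUV`), where each term is
`≤ (N+1)·C∕(N+1)⁶`. -/
theorem abs_sum_box_coord_mul_le_of_antiShift {f : Pt → ℝ} {C : ℝ} {a κ : Fin 4} (haκ : a ≠ κ) {σ : ℤ} (hσ : σ = 1 ∨ σ = -1)
    (hf : ∀ z, f (axisReflect a z + σ • unitVec a) = -f z) (hdec : ∀ z : Pt, |f z| ≤ C / ((supNorm z : ℝ) + 1) ^ 6)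
    {N : ℕ} (hN : 1 ≤ N) :
    |∑ t ∈ box 4 N, (t κ : ℝ) * f t| ≤ 80 * C / ((N : ℝ) + 1) ^ 2 := by
  obtain ⟨r, rfl⟩ : ∃ r, N = r + 1 := ⟨N - 1, by omega⟩
  have hC : 0 ≤ C := nonneg_of_sextic hdec
  let φ : Pt ≃ Pt := ⟨fun z => axisReflect a z + σ • unitVec a, fun z => axisReflect a z + σ • unitVec a,
    shiftRefl_shiftRefl a σ, shiftRefl_shiftRefl a σ⟩
  have hφ : ∀ z, φ z = axisReflect a z + σ • unitVec a := fun z => rfl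
  -- coordinates of `φ z`
  have hφκ : ∀ z : Pt, (φ z) κ = z κ := fun z => by
    rw [hφ]; simp only [Pi.add_apply, axisReflect_apply, Pi.smul_apply, unitVec_apply, if_neg (Ne.symm haκ),
      smul_eq_mul, mul_zero, add_zero]
  have hφi : ∀ (z : Pt) (i : Fin 4), i ≠ a → (φ z) i = z i := fun z i hi => by
    rw [hφ]; simp only [Pi.add_apply, axisReflect_apply, Pi.smul_apply, unitVec_apply, if_neg hi, smul_eq_mul, mul_zero, add_zero]
  have hφa : ∀ z : Pt, (φ z) a = -z a + σ := fun z => by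
    rw [hφ]; simp only [Pi.add_apply, axisReflect_apply, if_true, Pi.smul_apply, unitVec_apply, if_true, smul_eq_mul, mul_one]
  -- the extension by zero of the summand, and its φ-translate
  set G : Pt → ℝ := fun z => if supNorm z ≤ r + 1 then (z κ : ℝ) * f z else 0 with hG
  have hGsupp : ∀ z, z ∉ box 4 (r + 1) → G z = 0 := fun z hz => by
    rw [hG]; simp only; rw [if_neg (not_le.mpr (not_mem_box_iff.mp hz))]
  have hS : ∑ t ∈ box 4 (r + 1), (t κ : ℝ) * f t = ∑' z, G z := by
    rw [tsum_eq_sum (s := box 4 (r + 1)) (fun z hz => hGsupp z hz)]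
    refine Finset.sum_congr rfl fun t ht => ?_
    rw [hG]; simp only; rw [if_pos (mem_box_iff.mp ht)]
  -- `G ∘ φ`
  have hGφ : ∀ z, G (φ z) = -(if supNorm (φ z) ≤ r + 1 then (z κ : ℝ) * f z else 0) := fun z => by
    rw [hG]; simp only; rw [hφκ, hφ z, hf z]
    split_ifs <;> ring
  -- summability (finite supports inside `box 4 (r+2)`)
  have hmemφ : ∀ z : Pt, supNorm (φ z) ≤ r + 1 → z ∈ box 4 (r + 2) := by
    intro z hz
    rw [mem_box_iff, supNorm_le_iff]
    intro i
    rw [supNorm_le_iff] at hz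
    by_cases hi : i = a
    · subst hi
      have h1 := hz i
      rw [hφa] at h1
      rcases hσ with h | h <;> subst h <;> omega
    · have h1 := hz i
      rw [hφi z i hi] at h1
      omega
  have hsumG : Summable G := summable_of_ne_finset_zero (s := box 4 (r + 1)) fun z hz => hGsupp z hz
  have hsumGφ : Summable (fun z => G (φ z)) := by
    refine summable_of_ne_finset_zero (s := box 4 (r + 2)) fun z hz => ?_
    rw [hGφ]
    rw [if_neg (fun h => hz (hmemφ z h)), neg_zero]
  -- `2·S = Σ' (G + G∘φ)`
  have h2S : 2 * ∑' z, G z = ∑' z, (G z + G (φ z)) := by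
    rw [two_mul, hsumG.tsum_add hsumGφ, φ.tsum_eq G]
  -- the combined summand is supported on the two shells `‖z‖∞ ∈ {r+1, r+2}` and bounded there
  set H : Pt → ℝ := fun z => G z + G (φ z) with hH
  have hHsupp : ∀ z, H z ≠ 0 → z ∈ annulus 4 r (r + 2) := by
    intro z hz
    rw [mem_annulus_iff]
    rw [hH] at hz; simp only at hz; rw [hGφ, hG] at hz; simp only at hz
    by_cases h1 : supNorm z ≤ r + 1 <;> by_cases h2 : supNorm (φ z) ≤ r + 1
    · rw [if_pos h1, if_pos h2] at hz; simp at hz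
    · -- z in the box, φ z outside: the `a`-coordinate of `φ z` is large, so `|z a| ≥ r+1`
      refine ⟨?_, by omega⟩
      rw [supNorm_le_iff] at h1
      rw [supNorm_le_iff, not_forall] at h2
      obtain ⟨i, hi⟩ := h2
      by_cases hia : i = a
      · subst hia
        rw [hφa] at hi
        have h3 := h1 i
        have h4 : r < (z i).natAbs := by rcases hσ with h | h <;> subst h <;> omega
        exact lt_of_lt_of_le h4 (natAbs_le_supNorm z i)
      · rw [hφi z i hia] at hi
        exact absurd (h1 i) hi
    · -- z outside, φ z inside
      refine ⟨by omega, ?_⟩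
      rw [supNorm_le_iff]
      intro i
      rw [supNorm_le_iff] at h2
      by_cases hia : i = a
      · subst hia
        have h3 := h2 i
        rw [hφa] at h3
        rcases hσ with h | h <;> subst h <;> omega
      · have h3 := h2 i
        rw [hφi z i hia] at h3
        omega
    · rw [if_neg h1, if_neg h2] at hz; simp at hz
  have hHbd : ∀ z ∈ annulus 4 r (r + 2), |H z| ≤ ((r : ℝ) + 2) * (C / ((r : ℝ) + 2) ^ 6) := by
    intro z hz
    rw [mem_annulus_iff] at hz
    have hzκ : |(z κ : ℝ)| ≤ (r : ℝ) + 2 := by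
      have h1 : (z κ).natAbs ≤ r + 2 := (natAbs_le_supNorm z κ).trans hz.2
      rw [← Int.cast_abs]
      have h2 : |z κ| ≤ ((r + 2 : ℕ) : ℤ) := by rw [← Int.natCast_natAbs]; exact_mod_cast h1
      have h3 : ((|z κ| : ℤ) : ℝ) ≤ ((r + 2 : ℕ) : ℝ) := by exact_mod_cast h2
      simpa using h3
    have hfz : |f z| ≤ C / ((r : ℝ) + 2) ^ 6 := by
      refine (hdec z).trans (div_le_div_of_nonneg_left hC (by positivity) ?_)
      have : (r : ℝ) + 2 ≤ (supNorm z : ℝ) + 1 := by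
        have h1 : r + 1 ≤ supNorm z := hz.1
        have h2 : ((r + 1 : ℕ) : ℝ) ≤ (supNorm z : ℝ) := by exact_mod_cast h1
        push_cast at h2; linarith
      exact pow_le_pow_left₀ (by positivity) this 6
    -- |H z| ≤ |z κ|·|f z| in all four cases of the two indicators
    have hH1 : |H z| ≤ |(z κ : ℝ)| * |f z| := by
      rw [hH]; simp only; rw [hGφ, hG]; simp only
      by_cases h1 : supNorm z ≤ r + 1 <;> by_cases h2 : supNorm (φ z) ≤ r + 1
      · rw [if_pos h1, if_pos h2, add_neg_cancel, abs_zero]; positivity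
      · rw [if_pos h1, if_neg h2, neg_zero, add_zero, abs_mul]
      · rw [if_neg h1, if_pos h2, zero_add, abs_neg, abs_mul]
      · rw [if_neg h1, if_neg h2, neg_zero, add_zero, abs_zero]; positivity
    calc |H z| ≤ |(z κ : ℝ)| * |f z| := hH1
      _ ≤ ((r : ℝ) + 2) * (C / ((r : ℝ) + 2) ^ 6) :=
          mul_le_mul hzκ hfz (abs_nonneg _) (by positivity)
  -- sum over the two shells
  have hHtsum : ∑' z, H z = ∑ z ∈ annulus 4 r (r + 2), H z :=
    tsum_eq_sum (s := annulus 4 r (r + 2)) fun z hz => by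
      by_contra h; exact hz (hHsupp z h)
  have hcard : ((annulus 4 r (r + 2)).card : ℝ) ≤ 160 * ((r : ℝ) + 2) ^ 3 := by
    rw [annulus_eq_union (Nat.le_succ r) (Nat.le_succ (r + 1)), Finset.card_union_of_disjoint (disjoint_annulus r (r + 1) (r + 2))]
    push_cast
    have h1 := card_annulus_succ_four_le r
    have h2 := card_annulus_succ_four_le (r + 1)
    push_cast at h2
    have h3 : ((r : ℝ) + 1) ^ 3 ≤ ((r : ℝ) + 2) ^ 3 := pow_le_pow_left₀ (by positivity) (by linarith) 3
    nlinarith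
  have hbound : |∑' z, H z| ≤ 160 * ((r : ℝ) + 2) ^ 3 * (((r : ℝ) + 2) * (C / ((r : ℝ) + 2) ^ 6)) := by
    rw [hHtsum]
    calc |∑ z ∈ annulus 4 r (r + 2), H z| ≤ ∑ z ∈ annulus 4 r (r + 2), |H z| := Finset.abs_sum_le_sum_abs _ _
      _ ≤ ∑ z ∈ annulus 4 r (r + 2), ((r : ℝ) + 2) * (C / ((r : ℝ) + 2) ^ 6) := Finset.sum_le_sum hHbd
      _ = ((annulus 4 r (r + 2)).card : ℝ) * (((r : ℝ) + 2) * (C / ((r : ℝ) + 2) ^ 6)) := by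
          rw [Finset.sum_const, nsmul_eq_mul]
      _ ≤ 160 * ((r : ℝ) + 2) ^ 3 * (((r : ℝ) + 2) * (C / ((r : ℝ) + 2) ^ 6)) :=
          mul_le_mul_of_nonneg_right hcard (by positivity)
  -- conclude
  rw [hS]
  have h2 : 2 * |∑' z, G z| ≤ 160 * ((r : ℝ) + 2) ^ 3 * (((r : ℝ) + 2) * (C / ((r : ℝ) + 2) ^ 6)) := by
    have : |2 * ∑' z, G z| = 2 * |∑' z, G z| := by rw [abs_mul, abs_two]
    rw [← this, h2S]
    exact hbound
  have e : 160 * ((r : ℝ) + 2) ^ 3 * (((r : ℝ) + 2) * (C / ((r : ℝ) + 2) ^ 6)) = 2 * (80 * C / ((r : ℝ) + 2) ^ 2) := by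
    field_simp
    ring
  rw [e] at h2
  have e2 : (((r + 1 : ℕ) : ℝ) + 1) = (r : ℝ) + 2 := by push_cast; ring
  rw [e2]
  linarith

end Scalar

/-! ## §2 The kernel letter: first moments of `truncK K N` from (5.7) + (K6) -/

section Kernel

variable {K : EKer 4} {C : ℝ}

/-- [folklore] The flipped reflection law, unfolded (`OneStepKernelFamily.axisReflectionCovariant_flipK_iff`): for every axis `α` and channel `(c,e)`,
`K c e (ε_α z + [c=α]e_α − [e=α]e_α) = ε^α_c ε^α_e · K c e z`. -/
theorem cov_flip_apply (hcov : AxisReflectionCovariant (flipK K)) (α c e : Fin 4) (z : Pt) :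
    K c e (axisReflect α z + (if c = α then unitVec α else 0) - (if e = α then unitVec α else 0)) = reflSign α c * reflSign α e * K c e z :=
  (axisReflectionCovariant_flipK_iff K).mp hcov α c e z

/-- [folklore] `ε^α_c · ε^α_c = 1`. -/
theorem reflSign_mul_self (α c : Fin 4) : reflSign α c * reflSign α c = 1 := by
  unfold PolarizationSign.reflSign; split_ifs <;> norm_num

/-- [folklore] The first `κ`-moment of `truncK K N c e` as a box sum of `t_κ·K c e t`. -/
theorem tsum_coord_smul_truncK_eq_sum_box (K : EKer 4) (N : ℕ) (c e κ : Fin 4) :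
    ∑' t : Pt, t κ • truncK K N c e t = ∑ t ∈ box 4 N, (t κ : ℝ) * K c e t := by
  rw [tsum_smul_truncK_eq_sum K N c e (fun t => t κ)]
  refine Finset.sum_congr rfl fun t ht => ?_
  rw [truncK_apply, if_pos (mem_box_iff.mp ht), zsmul_eq_mul]

/-- **[folklore] EXACT VANISHING** of the first moments of the truncated kernel in the `ε_κ`-symmetric cases: `c = e` (the diagonal channels are
`ε_κ`-invariant for every `κ` — the two unit shifts cancel) or `κ ∉ {c, e}` (no shift at all). -/
theorem firstMoment_truncK_eq_zero_of_cov_flip (hcov : AxisReflectionCovariant (flipK K)) (N : ℕ) {c e κ : Fin 4}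
    (h : c = e ∨ (κ ≠ c ∧ κ ≠ e)) : ∑' t : Pt, t κ • truncK K N c e t = 0 := by
  rw [tsum_coord_smul_truncK_eq_sum_box]
  refine sum_box_coord_mul_eq_zero_of_invariant κ (fun z => ?_) N
  have h0 := cov_flip_apply hcov κ c e z
  rcases h with hce | ⟨hκc, hκe⟩
  · subst hce
    rw [add_sub_cancel_right, reflSign_mul_self, one_mul] at h0
    exact h0
  · rw [if_neg (Ne.symm hκc), if_neg (Ne.symm hκe), add_zero, sub_zero] at h0
    rw [h0]
    unfold PolarizationSign.reflSign
    rw [if_neg (Ne.symm hκc), if_neg (Ne.symm hκe), one_mul, one_mul]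

/-- **THE (T1)-LETTER OF THE TRUNCATED KERNEL FROM (5.7) + (K6)** [folklore]: for a kernel `K` on `ℤ⁴` with the printed reflection covariance in the kernel convention,
`AxisReflectionCovariant (flipK K)`, and sextic decay `|K c e t| ≤ C∕(‖t‖∞+1)⁶`, EVERY first moment of EVERY channel of the truncation `truncK K N` is small:
`|Σ' t, t κ • truncK K N c e t| ≤ 80·C∕(N+1)²` (`N ≥ 1`).  No Ward ∕ total-mass hypothesis is needed. -/
theorem abs_firstMoment_truncK_le_of_cov_flip (hK : ∀ c e (t : Pt), |K c e t| ≤ C / ((supNorm t : ℝ) + 1) ^ 6)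
    (hcov : AxisReflectionCovariant (flipK K)) {N : ℕ} (hN : 1 ≤ N) (c e κ : Fin 4) :
    |∑' t : Pt, t κ • truncK K N c e t| ≤ 80 * C / ((N : ℝ) + 1) ^ 2 := by
  have hC : 0 ≤ C := nonneg_of_sextic (hK c e)
  by_cases h : c = e ∨ (κ ≠ c ∧ κ ≠ e)
  · rw [firstMoment_truncK_eq_zero_of_cov_flip hcov N h, abs_zero]; positivity
  · -- the two in-plane off-diagonal cases: `c ≠ e` and `κ = c` or `κ = e`
    rw [not_or, not_and_or, not_not, not_not] at h
    obtain ⟨hce, hκ⟩ := h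
    rw [tsum_coord_smul_truncK_eq_sum_box]
    rcases hκ with hκc | hκe
    · -- κ = c: reflect the axis of the RIGHT index `e` (shift `−e_e`), which preserves `z_c`
      subst hκc
      refine abs_sum_box_coord_mul_le_of_antiShift (a := e) (Ne.symm hce) (σ := -1) (Or.inr rfl) (fun z => ?_) (hK κ e) hN
      have h0 := cov_flip_apply hcov e κ e z
      rw [if_neg hce, if_pos rfl, add_zero] at h0
      unfold PolarizationSign.reflSign at h0
      rw [if_neg hce, if_pos rfl] at h0
      rw [neg_smul, one_smul, ← sub_eq_add_neg, h0]; ring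
    · -- κ = e: reflect the axis of the LEFT index `c` (shift `+e_c`), which preserves `z_e`
      subst hκe
      refine abs_sum_box_coord_mul_le_of_antiShift (a := c) hce (σ := 1) (Or.inl rfl) (fun z => ?_) (hK c κ) hN
      have h0 := cov_flip_apply hcov c c κ z
      rw [if_pos rfl, if_neg (Ne.symm hce), sub_zero] at h0
      unfold PolarizationSign.reflSign at h0
      rw [if_pos rfl, if_neg (Ne.symm hce)] at h0
      rw [one_smul, h0]; ring

/-- **THE SAME IN THE `N⁻²` CURRENCY** of `HorizontalBookkeeping.pow_six_mul_abs_t0Defect_le`'s `hA` [folklore]: `|Σ' t, t κ • truncK K N c e t| ≤ (80·C)∕N²`. -/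
theorem abs_firstMoment_truncK_le_of_cov_flip' (hK : ∀ c e (t : Pt), |K c e t| ≤ C / ((supNorm t : ℝ) + 1) ^ 6)
    (hcov : AxisReflectionCovariant (flipK K)) {N : ℕ} (hN : 1 ≤ N) (c e κ : Fin 4) :
    |∑' t : Pt, t κ • truncK K N c e t| ≤ 80 * C / (N : ℝ) ^ 2 := by
  have hC : 0 ≤ C := nonneg_of_sextic (hK c e)
  have hN' : (1 : ℝ) ≤ N := by exact_mod_cast hN
  refine (abs_firstMoment_truncK_le_of_cov_flip hK hcov hN c e κ).trans ?_
  exact div_le_div_of_nonneg_left (by positivity) (by positivity) (pow_le_pow_left₀ (by positivity) (by linarith) 2)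

/-- [folklore] First moments of the truncation of the flipped kernel are minus those of the kernel (the sup-ball is symmetric). -/
theorem tsum_coord_smul_truncK_flipK (K : EKer 4) (N : ℕ) (c e κ : Fin 4) :
    ∑' t : Pt, t κ • truncK (flipK K) N c e t = -∑' t : Pt, t κ • truncK K N c e t := by
  rw [← tsum_neg, ← (Equiv.neg Pt).tsum_eq (fun t => -(t κ • truncK K N c e t))]
  refine tsum_congr fun t => ?_
  simp only [Equiv.neg_apply, truncK_apply, flipK_apply, supNorm_neg, Pi.neg_apply, neg_smul, neg_neg]

/-- **THE UNFLIPPED-COVARIANCE TWIN** [folklore]: the same letter from `AxisReflectionCovariant K`. -/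
theorem abs_firstMoment_truncK_le_of_cov (hK : ∀ c e (t : Pt), |K c e t| ≤ C / ((supNorm t : ℝ) + 1) ^ 6)
    (hcov : AxisReflectionCovariant K) {N : ℕ} (hN : 1 ≤ N) (c e κ : Fin 4) :
    |∑' t : Pt, t κ • truncK K N c e t| ≤ 80 * C / ((N : ℝ) + 1) ^ 2 := by
  have hK' : ∀ c e (t : Pt), |flipK K c e t| ≤ C / ((supNorm t : ℝ) + 1) ^ 6 := fun c e t => by
    rw [flipK_apply, ← supNorm_neg t]; exact hK c e (-t)
  have hcov' : AxisReflectionCovariant (flipK (flipK K)) := by rw [flipK_flipK]; exact hcov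
  have h := abs_firstMoment_truncK_le_of_cov_flip hK' hcov' hN c e κ
  rwa [tsum_coord_smul_truncK_flipK, abs_neg] at h

end Kernel

end Summit.QuantumFields.BalabanUV.Beta.FP.TruncatedFirstMoment

end
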